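import Mathlib
import Literature.Combinatorics.Optimization.ReflectionRelations
import Literature.Barriers.PneNP.TSPExtensionComplexityHyperplaneBound
import HarnessLib

/-!
# The regular `N`-gon sandwiches the unit disc: `cos(π/N)·D ⊆ P_N ⊆ D`, an `O(log N)`-size polyhedral
# approximation of the disc (Ben-Tal–Nemirovski) — PROVED

Sources. [KaibelPashkovich2011] §4.1.1 (arXiv:1011.3597 p. 9): "we obtain an extended formulation of a
regular `m`-gon with `⌈log(m)⌉ + 1` variables and `2⌈log(m)⌉ + 2` inequalities …, thus reproving a
result due to Ben-Tal and Nemirovski [BN01]" (in the tree: `RegularPolygon.hasEFOfSize_polygon`).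
[Kocuk2021] §1 (arXiv:1912.00256 p. 3), restating [BenTalNemirovski2001]: "Ben-Tal and Nemirovski have
shown that the second-order cone … can be outer-approximated to an arbitrary accuracy `ε` by a
polyhedral cone in an extended space. In their construction, the required number of additional
variables and linear inequalities grows polynomially in `N` and `log ε^{-1}` … Moreover, they also
prove that their construction is the smallest possible in size (up to a constant factor)."
The two-dimensional section of that statement is the regular polygon between two concentric discs;
this file records it for the tree's `N`-gon `RegularPolygon.polygon N` (Fawzi–Saunderson–Parrilo's
facet description `⟨u_j, p⟩ ≤ cos(π/N)`, `RegularPolygonPsdLifts.lean`).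

## What is proved (no named fact)

* `disc r = {p : p₁² + p₂² ≤ r²}`, `convex_disc`;
* `disc_subset_polygon : disc (cos(π/N)) ⊆ polygon N` (`N ≥ 2`; Cauchy–Schwarz against the unit facet
  normals) and `polygon_subset_disc : polygon N ⊆ disc 1` (`N ≥ 3`; the vertices are unit vectors and
  the disc is convex);
* the accuracy `one_sub_le_cos_pi_div : 1 − π²/(2N²) ≤ cos(π/N)`;
* **`BenTalNemirovski2001_polygon_sandwich`**: for `N ≥ 3` the polytope `polygon N` satisfies
  `disc (cos(π/N)) ⊆ polygon N ⊆ disc 1` and has an extended formulation with `2⌈log₂ N⌉ + 2`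
  inequalities — a `(1 − π²/(2N²))`-approximation of the unit disc of extension complexity `O(log N)`,
  i.e. accuracy `ε` at cost `O(log ε^{-1})`;
* `exists_nonneg_factorization_slack`: the slack matrix `RegularPolygon.slack N` of Fawzi–Saunderson–
  Parrilo has a nonnegative factorization through `2⌈log₂ N⌉ + 3` slots (Yannakakis' theorem, forward
  half `HasEFOfSize.exists_nonneg_factorization` of the tree), i.e. `rank₊(S_N) = O(log N)`.

Honest framing: Literature infrastructure on (approximate) extended formulations; nothing here bears
on `P ≠ NP`.
-/

noncomputable section

namespace Literature.Combinatorics.Optimization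

namespace RegularPolygon

open Real Matrix Literature.Barriers.PneNP

variable {N : ℕ}

/-- The closed disc of radius `r` about the origin. [cite: Kocuk2021, §1 (arXiv p. 3: the second-order cone `L^N`)] -/
def disc (r : ℝ) : Set (Fin 2 → ℝ) := {p | p 0 ^ 2 + p 1 ^ 2 ≤ r ^ 2}

/-- Discs are convex. [cite: Kocuk2021, §1 (arXiv p. 3)] -/
theorem convex_disc (r : ℝ) : Convex ℝ (disc r) := by
  intro x hx y hy a b ha hb hab
  simp only [disc, Set.mem_setOf_eq, Pi.add_apply, Pi.smul_apply, smul_eq_mul] at hx hy ⊢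
  have h0 : (a * x 0 + b * y 0) ^ 2 ≤ a * x 0 ^ 2 + b * y 0 ^ 2 := by
    nlinarith [mul_nonneg ha hb, sq_nonneg (x 0 - y 0), hab]
  have h1 : (a * x 1 + b * y 1) ^ 2 ≤ a * x 1 ^ 2 + b * y 1 ^ 2 := by
    nlinarith [mul_nonneg ha hb, sq_nonneg (x 1 - y 1), hab]
  nlinarith

/-- Cauchy–Schwarz against a unit facet normal: `⟨u_j, p⟩² ≤ p₁² + p₂²`.
[cite: Kocuk2021, §2.1 (arXiv p. 4: the rotations `(cos θ_j, sin θ_j)`)] -/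
theorem normal_dotProduct_sq_le (j : Fin N) (p : Fin 2 → ℝ) :
    (normal N j ⬝ᵥ p) ^ 2 ≤ p 0 ^ 2 + p 1 ^ 2 := by
  rw [normal_dotProduct]
  nlinarith [sin_sq_add_cos_sq (facetAngle N j),
    sq_nonneg (cos (facetAngle N j) * p 1 - sin (facetAngle N j) * p 0)]

/-- **Inner disc**: `cos(π/N)·D ⊆ P_N` (`N ≥ 2`). [cite: KaibelPashkovich2011, §4.1.1 (arXiv p. 9: the regular `m`-gon)] -/
theorem disc_subset_polygon (hN : 2 ≤ N) : disc (cos (π / N)) ⊆ polygon N := by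
  intro p hp j
  have hc : 0 ≤ cos (π / N) := by
    apply cos_nonneg_of_neg_pi_div_two_le_of_le
    · have : 0 ≤ π / N := by positivity
      linarith [pi_pos]
    · have hN' : (2 : ℝ) ≤ N := by exact_mod_cast hN
      have hNpos : (0 : ℝ) < N := by linarith
      rw [div_le_div_iff₀ hNpos two_pos]
      nlinarith [pi_pos]
  have h := (normal_dotProduct_sq_le j p).trans hp
  exact (abs_le_of_sq_le_sq' h hc).2

/-- The vertices are unit vectors. [cite: KaibelPashkovich2011, §4.1.1 (arXiv p. 9)] -/
theorem vertex_mem_disc_one (i : Fin N) : vertex N i ∈ disc 1 := by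
  simp only [disc, Set.mem_setOf_eq, vertex, Matrix.cons_val_zero, Matrix.cons_val_one, one_pow]
  nlinarith [sin_sq_add_cos_sq (vertexAngle N i), cos_sq_add_sin_sq (vertexAngle N i)]

/-- **Outer disc**: `P_N ⊆ D` (`N ≥ 3`). [cite: KaibelPashkovich2011, §4.1.1 (arXiv p. 9)] -/
theorem polygon_subset_disc (hN : 3 ≤ N) : polygon N ⊆ disc 1 := by
  haveI : NeZero N := ⟨by omega⟩
  rw [polygon_eq_convexHull hN]
  refine convexHull_min ?_ (convex_disc 1)
  rintro _ ⟨i, rfl⟩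
  exact vertex_mem_disc_one i

/-- The accuracy: `1 − π²/(2N²) ≤ cos(π/N)`. [cite: Kocuk2021, §1 (arXiv p. 3: "accuracy `ε` … `log ε^{-1}`")] -/
theorem one_sub_le_cos_pi_div (N : ℕ) : 1 - π ^ 2 / (2 * (N : ℝ) ^ 2) ≤ cos (π / N) := by
  have h := Real.one_sub_sq_div_two_le_cos (x := π / N)
  convert h using 2
  rcases Nat.eq_zero_or_pos N with h0 | hpos
  · subst h0; simp
  · field_simp

/-- **Ben-Tal–Nemirovski in the plane**: for `N ≥ 3` the regular `N`-gon `P_N` satisfies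
`cos(π/N)·D ⊆ P_N ⊆ D` and has an extended formulation with `2⌈log₂ N⌉ + 2` inequalities
(`cos(π/N) ≥ 1 − π²/(2N²)`: accuracy `ε` at cost `O(log ε^{-1})`).
[cite: KaibelPashkovich2011, Thm. 3 and §4.1.1 (arXiv p. 9)][cite: Kocuk2021, §1 (arXiv p. 3)] -/
theorem BenTalNemirovski2001_polygon_sandwich (hN : 3 ≤ N) :
    disc (cos (π / N)) ⊆ polygon N ∧ polygon N ⊆ disc 1 ∧ HasEFOfSize (polygon N) (2 * Nat.clog 2 N + 2) :=
  ⟨disc_subset_polygon (by omega), polygon_subset_disc hN, hasEFOfSize_polygon hN⟩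


/-- The vertices lie in the polygon. [cite: KaibelPashkovich2011, §4.1.1 (arXiv p. 9)] -/
theorem vertex_mem_polygon (hN : 3 ≤ N) (i : Fin N) : vertex N i ∈ polygon N := by
  haveI : NeZero N := ⟨by omega⟩
  rw [polygon_eq_convexHull hN]
  exact subset_convexHull ℝ _ ⟨i, rfl⟩

/-- **The slack matrix of the regular `N`-gon has nonnegative rank `≤ 2⌈log₂ N⌉ + 3`** (`N ≥ 3`): by
Yannakakis' factorization theorem (forward half, in the tree) applied to the `O(log N)` extended
formulation — `S_{ij} = cos(π/N) − ⟨u_j, x_i⟩ = Σ_t U_j(t) T_i(t)` with `U, T ≥ 0` over `2⌈log₂ N⌉ + 3`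
slots. [cite: KaibelPashkovich2011, Thm. 3 (arXiv p. 9)][cite: Rothvoss2017, Thm. 4 (PDF p. 5: Yannakakis' factorization)] -/
theorem exists_nonneg_factorization_slack (hN : 3 ≤ N) :
    ∃ (U : Fin N → Option (Fin (2 * Nat.clog 2 N + 2)) → ℝ) (T : Fin N → Option (Fin (2 * Nat.clog 2 N + 2)) → ℝ),
      (∀ j t, 0 ≤ U j t) ∧ (∀ i t, 0 ≤ T i t) ∧ ∀ i j, slack N i j = ∑ t, U j t * T i t := by
  obtain ⟨U, T, hU, hT, hS⟩ := (hasEFOfSize_polygon hN).exists_nonneg_factorization (vertex N)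
    (vertex_mem_polygon hN) (normal N) (fun _ => Real.cos (π / N)) (fun j x hx => hx j)
  refine ⟨U, T, hU, hT, fun i j => ?_⟩
  rw [slack, Matrix.of_apply]
  exact hS j i

end RegularPolygon

end Literature.Combinatorics.Optimization

end
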